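import Summits.BirchSwinnertonDyer.BirchSwinnertonDyer.Theorems.PrintCf2RubinValueTwoCClassUpsilonSurjects
import Literature.NumberTheory.EllipticCurves.Agboola2007.RestrictedSelmerGroups
import Literature.NumberTheory.GaloisRepresentations.DecompositionGroupOfCompletion
import HarnessLib

/-!
# [T3]-input, part 3: the one displayed door reduced to «`E′[4]` is ramified at some place `w ∤ 2`»

Cell `bsd-print-cf2`, width seat `bsd-line-cf2-p1-w8` g6; class item `MainConjClauseAtSplitTwoQuadDAClass` (rev 23,
`stmt-BirchSwinnertonDyer-23300`); step (0) of cf2c-w2 g8's (Q)-class RECIPE 15:38:32Z.  `--supports` 23300 (helper);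
Theses-free; THEOREMS ONLY; 0 facts.  Parts 1–2 = `…CClassUpsilonSigns`, `…CClassUpsilonSurjects`.

* §1 ★ `fix_iff_fix_of_smul_sqrt_neg_one_eq_self` — if some `τ₀` negates `√−1`, then every `σ` FIXING `√−1` has a
  DIAGONAL sign pattern on the layers (`Fix₁ σ ↔ Fix₂ σ`): part 1's Weil constraint applied to `τ₀` and `στ₀`.
* §2 `inertia_le_pairKer` (`κ₁` unramified outside `v`, `κ₂` outside `v̄` ⟹ `I_w ≤ pairKer κ₁ κ₂` for `w ≠ v, v̄`);
  `smul_eq_self_of_mem_inertia_of_sq_eq_neg_one` (`I_w` fixes `√−1` for `w ∤ 2`; tree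
  `smul_eq_self_of_mem_inertia_of_pow_prime_pow_eq_one` + `inertia_adicCompletionPrime_eq_map_absInertia`).
* §3 ★ `exists_mem_pairKer_mul_mem_qDivisionFieldSubgroup_two_of_moves` — door (hI) «some `σ ∈ pairKer` fixing `√−1`
  moves `E[4]`» suffices; ★★ `…_of_inertia` — door (hNOS) **«some `σ ∈ I_w`, `w ∤ 2`, moves `E[4]`»** (`E[4]` RAMIFIED at
  an odd place) suffices, given the class item's `κ₁.IsUnramifiedOutside v`, `κ₂.IsUnramifiedOutside v̄`;
  ★★ `…_of_deuring_of_inertia` — the Deuring frame of the class's good twist `W′/ℚ`: the door is a statement about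
  `W′.baseChange K` ALONE (no component data): `∃ w, 2 ∉ w ∧ ∃ σ ∈ GreenbergSelmer.inertia w,
  σ ∉ (W′.baseChange K).qDivisionFieldSubgroup 2`.

Supplier note: for the cm7 class (`j = −3375`, conductor `49·d²`) the door holds at `w = (√−7)` — `E′/K` has additive
(potentially good) reduction there and inertia acts on `T₂E′` through `𝓞_K^× = ±1` non-trivially (Néron–Ogg–Shafarevich
/ Serre–Tate); the tree has the `p ≥ 3` analogue `WeierstrassCurve.exists_inertia_smul_ne_of_hasAdditiveReductionAt`
(Kodaira–Néron count `#Φ ≤ 4 < p²`); the same count `4 < 16 = #E[4]` gives the level-`4` statement — NOT typed here.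
HONEST FRAMING: closes nothing by itself; no summit statement is proved by this seat; BSD is not proved by any of this.

## References
* [SilvermanAEC2009] J. H. Silverman, *The Arithmetic of Elliptic Curves* (2009), III.8.1, VII.7.1.
* [SerreTate1968] J.-P. Serre, J. Tate, *Good reduction of abelian varieties*, Ann. Math. 88 (1968), Thm. 1, §6.
* [Rubin1999] K. Rubin, LNM 1716 (1999), §5 Prop. 5.4, Thm. 5.15 (ii), (7).
* [Washington1997] L. C. Washington, *Introduction to Cyclotomic Fields* (1997), §13.1–13.2.
-/

-- the summit namespace `Summit.BirchSwinnertonDyer.BirchSwinnertonDyer` repeats the problem name by design (D-0017)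
set_option linter.dupNamespace false
set_option autoImplicit false

noncomputable section

open scoped Classical

open Field NumberField IsDedekindDomain WeierstrassCurve Literature.NumberTheory.EllipticCurves
  Literature.NumberTheory.GaloisRepresentations

namespace Summit.BirchSwinnertonDyer.BirchSwinnertonDyer.Theorems.PrintCf2.UpsilonSurjects

section Abstract

variable {K : Type} [Field K] (W : WeierstrassCurve K)

/-! ## §1. Diagonal patterns for elements fixing `√−1` -/

/-- ★ **If some `τ₀` negates `r` (`r² = −1`), every `σ` with `σ • r = r` fixes BOTH layers `M₁[4], M₂[4]` or NEITHER**
(`τ₀` and `στ₀` both negate `r`, so both have mixed patterns by the Weil constraint; signs multiply).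
[cite: SilvermanAEC2009, III.8.1] [cite: Rubin1999, §5 Prop. 5.4] -/
theorem fix_iff_fix_of_smul_sqrt_neg_one_eq_self [CharZero K] [W.IsElliptic]
    (M₁ M₂ : AddSubgroup (geomPrimaryTorsion W 2)) (hsup : M₁ ⊔ M₂ = ⊤) (hinf : M₁ ⊓ M₂ = ⊥)
    (hst₁ : ∀ σ : absoluteGaloisGroup K, ∀ x ∈ M₁, σ • x ∈ M₁)
    (hst₂ : ∀ σ : absoluteGaloisGroup K, ∀ x ∈ M₂, σ • x ∈ M₂)
    {g₁ g₂ : geomPrimaryTorsion W 2} (hord₁ : addOrderOf g₁ = 2 ^ 2) (hord₂ : addOrderOf g₂ = 2 ^ 2)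
    (hg₁ : M₁ ⊓ AddSubgroup.torsionBy (geomPrimaryTorsion W 2) (2 ^ 2) = AddSubgroup.zmultiples g₁)
    (hg₂ : M₂ ⊓ AddSubgroup.torsionBy (geomPrimaryTorsion W 2) (2 ^ 2) = AddSubgroup.zmultiples g₂)
    {r : AlgebraicClosure K} (hr : r ^ 2 = -1) {τ₀ : absoluteGaloisGroup K} (hτ₀ : τ₀ • r = -r)
    {σ : absoluteGaloisGroup K} (hσ : σ • r = r) :
    (∀ x ∈ M₁ ⊓ AddSubgroup.torsionBy (geomPrimaryTorsion W 2) (2 ^ 2), σ • x = x) ↔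
      (∀ x ∈ M₂ ⊓ AddSubgroup.torsionBy (geomPrimaryTorsion W 2) (2 ^ 2), σ • x = x) := by
  have m₀ := fix_iff_not_fix_of_smul_sqrt_neg_one W M₁ M₂ hsup hinf hst₁ hst₂ hord₁ hord₂ hg₁ hg₂ hr hτ₀
  have hστ : (σ * τ₀) • r = -r := by rw [mul_smul, hτ₀, smul_neg, hσ]
  have m₁ := fix_iff_not_fix_of_smul_sqrt_neg_one W M₁ M₂ hsup hinf hst₁ hst₂ hord₁ hord₂ hg₁ hg₂ hr hστ
  rw [fix_mul_iff W hst₁ hord₁ hg₁ σ τ₀, fix_mul_iff W hst₂ hord₂ hg₂ σ τ₀] at m₁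
  set A := ∀ x ∈ M₁ ⊓ AddSubgroup.torsionBy (geomPrimaryTorsion W 2) (2 ^ 2), σ • x = x with hA
  set B := ∀ x ∈ M₂ ⊓ AddSubgroup.torsionBy (geomPrimaryTorsion W 2) (2 ^ 2), σ • x = x with hB
  set C := ∀ x ∈ M₁ ⊓ AddSubgroup.torsionBy (geomPrimaryTorsion W 2) (2 ^ 2), τ₀ • x = x with hC
  set D := ∀ x ∈ M₂ ⊓ AddSubgroup.torsionBy (geomPrimaryTorsion W 2) (2 ^ 2), τ₀ • x = x with hD
  clear_value A B C D
  tauto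

end Abstract

/-! ## §2. Inertia at `w ∉ {v, v̄}`: inside `pairKer`, and fixing `√−1` when `w ∤ 2` -/

section Inertia

variable {K : Type} [Field K] [NumberField K]

/-- **`I_w ≤ Gal(K̄/K̃_∞)` for `w ≠ v, v̄`** when `κ₁` is unramified outside `v` and `κ₂` outside `v̄` (the class item's
hypotheses; `pairKer = ker κ₁ ⊓ ker κ₂`). [cite: Washington1997, §13.1–13.2] -/
theorem inertia_le_pairKer {p : ℕ} [Fact p.Prime] {κ₁ κ₂ : ZpExtension K p} {v vbar w : HeightOneSpectrum (𝓞 K)}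
    (h₁ : κ₁.IsUnramifiedOutside v) (h₂ : κ₂.IsUnramifiedOutside vbar) (hw₁ : w ≠ v) (hw₂ : w ≠ vbar) :
    GreenbergSelmer.inertia w ≤ ZpExtension.pairKer κ₁ κ₂ :=
  le_inf (h₁ w hw₁) (h₂ w hw₂)

/-- **Inertia at `w ∤ 2` fixes `√−1`** (`I_w = I_{𝔓_w}` for the prime `𝔓_w` of `ℤ̄_K` cut out by `K̄ → K̄_w`, and inertia
prime to `2` fixes the `4`-th roots of unity). [cite: Washington1997, §13.2] -/
theorem smul_eq_self_of_mem_inertia_of_sq_eq_neg_one {w : HeightOneSpectrum (𝓞 K)}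
    (hw : ((2 : ℕ) : 𝓞 K) ∉ w.asIdeal) {σ : absoluteGaloisGroup K} (hσ : σ ∈ GreenbergSelmer.inertia w)
    {i : AlgebraicClosure K} (hi : i ^ 2 = -1) : σ • i = i := by
  have hIeq : GreenbergSelmer.inertia w = (adicCompletionPrime K w).inertia (absoluteGaloisGroup K) :=
    (inertia_adicCompletionPrime_eq_map_absInertia K w).symm
  rw [hIeq] at hσ
  have hi4 : i ^ 2 ^ 2 = 1 := by
    rw [show (2 : ℕ) ^ 2 = 2 * 2 by norm_num, pow_mul, hi]
    norm_num
  exact smul_eq_self_of_mem_inertia_of_pow_prime_pow_eq_one (ℓ := 2) (n := 2) hw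
    (adicCompletionPrime_mem_primesAbove K w) hσ hi4

end Inertia

/-! ## §3. The doors (hI) and (hNOS) for `Υ = pairKer κ₁ κ₂`, `K = ℚ(√−7)` -/

section PairKer

variable {K : Type} [Field K] [NumberField K]

/-- ★ **Door (hI)**: `K` imaginary quadratic, `d_K = −7`, `(κ; γ)` a generator pair, `W/K` elliptic with the two stable
components and cyclic order-`4` layers; if **some `σ ∈ pairKer κ₁ κ₂` fixes `√−1` and moves `E[4]`**, then
`∀ h, ∃ τ ∈ pairKer κ₁ κ₂, h * τ ∈ W.qDivisionFieldSubgroup 2` (such `σ` has pattern `(−,−)` by §1: door (hFF) of part 2).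
[cite: Rubin1999, §5 Prop. 5.4, (7)] [cite: SilvermanAEC2009, III.8.1] -/
theorem exists_mem_pairKer_mul_mem_qDivisionFieldSubgroup_two_of_moves (hK : IsImaginaryQuadratic K)
    (hdK : NumberField.discr K = -7) (W : WeierstrassCurve K) [W.IsElliptic]
    (M₁ M₂ : AddSubgroup (geomPrimaryTorsion W 2)) (hsup : M₁ ⊔ M₂ = ⊤) (hinf : M₁ ⊓ M₂ = ⊥)
    (hst₁ : ∀ σ : absoluteGaloisGroup K, ∀ x ∈ M₁, σ • x ∈ M₁)
    (hst₂ : ∀ σ : absoluteGaloisGroup K, ∀ x ∈ M₂, σ • x ∈ M₂)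
    {g₁ g₂ : geomPrimaryTorsion W 2} (hord₁ : addOrderOf g₁ = 2 ^ 2) (hord₂ : addOrderOf g₂ = 2 ^ 2)
    (hg₁ : M₁ ⊓ AddSubgroup.torsionBy (geomPrimaryTorsion W 2) (2 ^ 2) = AddSubgroup.zmultiples g₁)
    (hg₂ : M₂ ⊓ AddSubgroup.torsionBy (geomPrimaryTorsion W 2) (2 ^ 2) = AddSubgroup.zmultiples g₂)
    {κ₁ κ₂ : ZpExtension K 2} {γ₁ γ₂ : absoluteGaloisGroup K} (hγ : ZpExtension.IsTopGeneratorPair κ₁ κ₂ γ₁ γ₂)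
    (hI : ∃ σ ∈ ZpExtension.pairKer κ₁ κ₂,
      (∃ i : AlgebraicClosure K, i ^ 2 = -1 ∧ σ • i = i) ∧ σ ∉ W.qDivisionFieldSubgroup 2)
    (h : absoluteGaloisGroup K) :
    ∃ τ ∈ ZpExtension.pairKer κ₁ κ₂, h * τ ∈ W.qDivisionFieldSubgroup 2 := by
  obtain ⟨σ, hσ, ⟨i, hi, hσi⟩, hmov⟩ := hI
  obtain ⟨τ₀, -, hτ₀⟩ := HPrime.exists_mem_pairKer_smul_sqrt_neg_one_eq_neg hK hdK hγ hi
  have hdiag := fix_iff_fix_of_smul_sqrt_neg_one_eq_self W M₁ M₂ hsup hinf hst₁ hst₂ hord₁ hord₂ hg₁ hg₂ hi hτ₀ hσi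
  have hnot : ¬ ((∀ x ∈ M₁ ⊓ AddSubgroup.torsionBy (geomPrimaryTorsion W 2) (2 ^ 2), σ • x = x) ∧
      (∀ x ∈ M₂ ⊓ AddSubgroup.torsionBy (geomPrimaryTorsion W 2) (2 ^ 2), σ • x = x)) := by
    intro hb
    apply hmov
    rw [mem_qDivisionFieldSubgroup_iff, show qTorsionLevel 2 = 2 ^ 2 by simp [qTorsionLevel]]
    exact (forall_smul_geomTorsion_four_eq_self_iff W M₁ M₂ hsup hinf σ).mpr hb
  exact exists_mem_pairKer_mul_mem_qDivisionFieldSubgroup_two hK hdK W M₁ M₂ hsup hinf hst₁ hst₂ hord₁ hord₂ hg₁ hg₂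
    hγ (Or.inl ⟨σ, hσ, fun h1 ↦ hnot ⟨h1, hdiag.mp h1⟩, fun h2 ↦ hnot ⟨hdiag.mpr h2, h2⟩⟩) h

/-- ★★ **Door (hNOS) — `E[4]` RAMIFIED at some place `w ∤ 2`**: with `κ₁` unramified outside `v ∣ 2` and `κ₂` outside
`v̄ ∣ 2` (the class item's hypotheses), an inertia element `σ ∈ I_w`, `w ∤ 2`, moving `E[4]` lies in `pairKer` (§2),
fixes `√−1` (§2), hence is the `σ` of door (hI): `∀ h, ∃ τ ∈ pairKer κ₁ κ₂, h * τ ∈ W.qDivisionFieldSubgroup 2`.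
[cite: SerreTate1968, Thm. 1] [cite: Rubin1999, §5 Prop. 5.4, Thm. 5.15 (ii)] [cite: Washington1997, §13.2] -/
theorem exists_mem_pairKer_mul_mem_qDivisionFieldSubgroup_two_of_inertia (hK : IsImaginaryQuadratic K)
    (hdK : NumberField.discr K = -7) (W : WeierstrassCurve K) [W.IsElliptic]
    (M₁ M₂ : AddSubgroup (geomPrimaryTorsion W 2)) (hsup : M₁ ⊔ M₂ = ⊤) (hinf : M₁ ⊓ M₂ = ⊥)
    (hst₁ : ∀ σ : absoluteGaloisGroup K, ∀ x ∈ M₁, σ • x ∈ M₁)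
    (hst₂ : ∀ σ : absoluteGaloisGroup K, ∀ x ∈ M₂, σ • x ∈ M₂)
    {g₁ g₂ : geomPrimaryTorsion W 2} (hord₁ : addOrderOf g₁ = 2 ^ 2) (hord₂ : addOrderOf g₂ = 2 ^ 2)
    (hg₁ : M₁ ⊓ AddSubgroup.torsionBy (geomPrimaryTorsion W 2) (2 ^ 2) = AddSubgroup.zmultiples g₁)
    (hg₂ : M₂ ⊓ AddSubgroup.torsionBy (geomPrimaryTorsion W 2) (2 ^ 2) = AddSubgroup.zmultiples g₂)
    {κ₁ κ₂ : ZpExtension K 2} {γ₁ γ₂ : absoluteGaloisGroup K} (hγ : ZpExtension.IsTopGeneratorPair κ₁ κ₂ γ₁ γ₂)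
    {v vbar : HeightOneSpectrum (𝓞 K)} (hκ₁ : κ₁.IsUnramifiedOutside v) (hκ₂ : κ₂.IsUnramifiedOutside vbar)
    (hv : ((2 : ℕ) : 𝓞 K) ∈ v.asIdeal) (hvbar : ((2 : ℕ) : 𝓞 K) ∈ vbar.asIdeal)
    (hram : ∃ w : HeightOneSpectrum (𝓞 K), ((2 : ℕ) : 𝓞 K) ∉ w.asIdeal ∧
      ∃ σ ∈ GreenbergSelmer.inertia w, σ ∉ W.qDivisionFieldSubgroup 2)
    (h : absoluteGaloisGroup K) :
    ∃ τ ∈ ZpExtension.pairKer κ₁ κ₂, h * τ ∈ W.qDivisionFieldSubgroup 2 := by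
  obtain ⟨w, hw, σ, hσ, hmov⟩ := hram
  have hw₁ : w ≠ v := fun he ↦ hw (he ▸ hv)
  have hw₂ : w ≠ vbar := fun he ↦ hw (he ▸ hvbar)
  obtain ⟨i, hi⟩ := IsAlgClosed.exists_pow_nat_eq (-1 : AlgebraicClosure K) (by norm_num : 0 < 2)
  exact exists_mem_pairKer_mul_mem_qDivisionFieldSubgroup_two_of_moves hK hdK W M₁ M₂ hsup hinf hst₁ hst₂ hord₁ hord₂
    hg₁ hg₂ hγ ⟨σ, inertia_le_pairKer hκ₁ hκ₂ hw₁ hw₂ hσ,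
      ⟨i, hi, smul_eq_self_of_mem_inertia_of_sq_eq_neg_one hw hσ hi⟩, hmov⟩ h

/-- ★★ **[T3]-input for the class (c)-half, Deuring frame, door (hNOS)**: `W′/ℚ` with CM by `𝓞_K` (`K` imaginary
quadratic, `d_K = −7`), Deuring frame `(c, ψ′)`, `2 = v·v̄`, the Deuring split print; `(κ; γ)` a generator pair with
`κ₁` unramified outside `v`, `κ₂` outside `v̄`; and ONE displayed fact about `W′.baseChange K` alone — **`E′[4]` is
ramified at some place `w ∤ 2`** (`∃ w, 2 ∉ w ∧ ∃ σ ∈ I_w, σ ∉ (W′.baseChange K).qDivisionFieldSubgroup 2`; true for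
the cm7 class at `w = (√−7)` by Néron–Ogg–Shafarevich, not typed here).  THEN every `h ∈ Γ_K` has `τ ∈ pairKer κ₁ κ₂`
with `h * τ ∈ (W′.baseChange K).qDivisionFieldSubgroup 2` — step (0) of the (Q)-class RECIPE.
[cite: Rubin1999, §5 Prop. 5.4, Cor. 5.5, Thm. 5.15 (ii), (7)] [cite: SerreTate1968, Thm. 1] [cite: SilvermanAEC2009, III.8.1] -/
theorem exists_mem_pairKer_mul_mem_qDivisionFieldSubgroup_two_of_deuring_of_inertia
    (hDG : Deuring_galoisAction_cmPrimaryTorsion_split)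
    (W : WeierstrassCurve ℚ) [W.IsElliptic] [W.IsGloballyMinimal] (hj : W.j ∈ maximalCMJInvariants)
    (K : Type) [Field K] [NumberField K] (hKq : IsImaginaryQuadratic K) (hdK : NumberField.discr K = -7)
    (hK : IsCMFieldOfJ K W.j) (c : K ≃ₐ[ℚ] K) (hc : c ≠ 1)
    (ψ : HeckeCharacter K) (hψ : ψ.HasInfinityType (fun _ ↦ 1) (fun _ ↦ 0)) (hψc : IsHeckeConjEquivariant c ψ)
    (hL : ∀ s : ℂ, 3 / 2 < s.re → heckeLFunction ψ s = W.LSeries s)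
    (v vbar : HeightOneSpectrum (𝓞 K))
    (hv : ((2 : ℕ) : 𝓞 K) ∈ v.asIdeal) (hvbar : ((2 : ℕ) : 𝓞 K) ∈ vbar.asIdeal) (hne : vbar ≠ v)
    {κ₁ κ₂ : ZpExtension K 2} {γ₁ γ₂ : absoluteGaloisGroup K} (hγ : ZpExtension.IsTopGeneratorPair κ₁ κ₂ γ₁ γ₂)
    (hκ₁ : κ₁.IsUnramifiedOutside v) (hκ₂ : κ₂.IsUnramifiedOutside vbar)
    (hram : ∃ w : HeightOneSpectrum (𝓞 K), ((2 : ℕ) : 𝓞 K) ∉ w.asIdeal ∧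
      ∃ σ ∈ GreenbergSelmer.inertia w, σ ∉ (W.baseChange K).qDivisionFieldSubgroup 2)
    (h : absoluteGaloisGroup K) :
    ∃ τ ∈ ZpExtension.pairKer κ₁ κ₂, h * τ ∈ (W.baseChange K).qDivisionFieldSubgroup 2 := by
  obtain ⟨M, hinf, hsup, h₁, h₂⟩ := hDG W hj K hK c hc ψ hψ hψc hL 2 v vbar hv hvbar hne
  obtain ⟨g₁, -, hord₁, hg₁⟩ := h₁.exists_generator 2
  obtain ⟨g₂, -, hord₂, hg₂⟩ := h₂.exists_generator 2
  exact exists_mem_pairKer_mul_mem_qDivisionFieldSubgroup_two_of_inertia hKq hdK (W.baseChange K) (M v) (M vbar)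
    hsup hinf h₁.smul_mem h₂.smul_mem hord₁ hord₂ hg₁ hg₂ hγ hκ₁ hκ₂ hv hvbar hram h

end PairKer

end Summit.BirchSwinnertonDyer.BirchSwinnertonDyer.Theorems.PrintCf2.UpsilonSurjects
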